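import Literature.Barriers.AtomisticToContinuum.KineticGapLengthScalesAssembly
import Literature.MathematicalPhysics.QuantumManyBody.GeneralizedPoincareProofs
import Literature.MathematicalPhysics.QuantumManyBody.EnergyLocalizationProofs
import HarnessLib

/-!
# LSSY Theorem 5.1 (periodic case): the discharge

`Literature/Barriers/AtomisticToContinuum`, proofs file of `KineticGapLengthScales.lean`
(provefacts `Literature.Barriers.AtomisticToContinuum.BoseGas.LSSY2005_thm51_periodic` and
`Literature.Barriers.AtomisticToContinuum.KineticGapLengthScales`, which are definitionally the
same proposition, `kineticGapLengthScales_iff`): [LSSY2005, Thm. 5.1 (5.4)], complete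
Bose–Einstein condensation of the ground state of the dilute Bose gas in the Gross–Pitaevskii
limit (`N → ∞` with `ρ` and `g = Na/L` fixed), periodic box.

The printed proof [LSSY2005, p. 25 of the arXiv edition] combines Lemma 5.2 (localization of
the energy) and Lemma 4.1 (the generalized Poincaré inequality) with the upper bound (2.14). In
the tree the combination (5.15)–(5.17) is `LSSY2005_thm51_periodic_of_lemmas`
(`KineticGapLengthScalesAssembly.lean`), Lemma 4.1 is `LSSY2005_lemma41_periodic_holds`
(`GeneralizedPoincareProofs.lean`) and Lemma 5.2 is `LSSY2005_lemma52_periodic_holds`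
(`EnergyLocalizationProofs.lean`); this file only puts the three together. Theorems only.

## References

* [LSSY2005] E. H. Lieb, R. Seiringer, J. P. Solovej, J. Yngvason, *The Mathematics of the Bose
  Gas and its Condensation*, Oberwolfach Seminars 34, Birkhäuser 2005 (arXiv:cond-mat/0610117):
  Thm. 5.1 (5.4) and its proof (5.15)–(5.17), Lemma 5.2 (5.7)–(5.14), p. 25 of the arXiv
  edition; Lemma 4.1 (4.2); Thm. 2.2 (2.14).
-/

namespace Literature.Barriers.AtomisticToContinuum.BoseGas

open Literature.MathematicalPhysics.QuantumManyBody.BoseGas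

/-- **LSSY 2005, Theorem 5.1 (BEC in a dilute limit), periodic case — the named fact
`LSSY2005_thm51_periodic` holds.** For every repulsive finite-range `v₁` of scattering length
`1` and all `ρ, g > 0`: with `L_N = (N/ρ)^{1/3}`, `a_N = gL_N/N` and the interaction
`a_N⁻² v₁(·/a_N)`, the ground-state condensate occupation of the periodic box satisfies
`⟨φ₀, γ_N φ₀⟩/N → 1` as `N → ∞`, i.e. `N⁻¹L⁻³∬γ(x, y) dx dy → 1` (5.4). Proof: Lemma 4.1
(`LSSY2005_lemma41_periodic_holds`) and Lemma 5.2 (`LSSY2005_lemma52_periodic_holds`) fed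
into the assembly (5.15)–(5.17) (`LSSY2005_thm51_periodic_of_lemmas`).
[cite: LSSY2005, Thm. 5.1 (5.4)] -/
theorem LSSY2005_thm51_periodic_holds : LSSY2005_thm51_periodic :=
  LSSY2005_thm51_periodic_of_lemmas LSSY2005_lemma41_periodic_holds
    LSSY2005_lemma52_periodic_holds

end Literature.Barriers.AtomisticToContinuum.BoseGas

namespace Literature.Barriers.AtomisticToContinuum

/-- **The catalogue entry `KineticGapLengthScales` holds** — its formal content is LSSY
Thm. 5.1, periodic case (`kineticGapLengthScales_iff`), now proved
(`BoseGas.LSSY2005_thm51_periodic_holds`). As recorded in the entry's `scope_caveats`, proving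
the positive theorem neither settles nor evades the catalogued obstruction.
[cite: LSSY2005, Thm. 5.1 (5.4)] -/
theorem KineticGapLengthScales_holds : KineticGapLengthScales :=
  BoseGas.LSSY2005_thm51_periodic_holds

end Literature.Barriers.AtomisticToContinuum
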